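import Summits.QuantumFields.YangMills.Theorems.BalabanUVNodesPortS1QtCDtUniform

/-!
# Port S1, socket (o1) — THE NAME `recordDt`: print's `D̃(B)` (p.267) AS A TOTAL FUNCTION AT THE RECORD (director-ym g23 №594 (5): «the ONE missing name = `recordDt`: ▶ PTA-1 — land it as a DEF,
# unique-fixed-point selector, 0-junk off the ball, spec = lit ✓`B12Lineariz267.exists_Dt` ∕ uniqueness»; ★★ DEF-1 g39's pointwise-selector shape, nodeO STATUS l.5834)

Cell `ym-nodeO-ideate`, porter seat PT-A-1 (gen 9); `--kind definition --supports stmt-QuantumFields-27930 --as helper`; count-neutral.  [I] = [Balaban1987RG1]; [15] = [Balaban1985Variational].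

WHAT THIS FILE IS.
* §1 ★★★ `recordDt F k K Vk ρ B` — the POINTWISE SELECTOR: if some coarse field `X` in the closed ball `4C₂ρ²` solves `C̃_ℂ(Vk)(B − h_ℂ X) = X` (`C₂ = 2∕R²`, `R = 1∕(10⁸dL)`), choose one; else `0`.
  TOTAL and hypothesis-free; the RADIUS `ρ` IS QUANTIFIED (a parameter): the admissible radii are those of (o1-ε) ✓`exists_recordDt` (`9C₂bρ < 1`, `3ρ ≤ R` under `‖h_ℂ‖ ≤ b`), and the k-UNIFORM
  PINNED choice is `ρ₀(d, L, α) = min (R∕3) (1∕(18C₂(b+1)))`, `b = 6∕(L^{1−d} − 157α)` of (o1-ζ) ✓`exists_recordDt_uniform` (§3).  JUNK (said): `0` off existence; off the smallness letters the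
  chosen solution need not be print's.
* §2 (quantified radius) `recordDt_of_not_exists`; ★ `recordDt_spec` (in the ball and a fixed point, for `‖B‖ < ρ` under the (o1-ε) letters — `exists_recordDt` + `choose_spec`); ★ `eq_recordDt_of_solution`
  (UNIQUENESS: every solution family in the ball IS `recordDt` — lit `Dt_unique`); `recordDt_zero`; `norm_recordDt_le_sq` (`‖D̃(B)‖ ≤ 4C₂‖B‖²`); `norm_hop_recordDt_le'`; ★★ `recordQtC_sub_hop_recordDt_eq`
  (THE LINEARISATION `Q̃_ℂ(B − h_ℂ D̃(B)) = LQ̃_ℂ B`).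
* §3 (pinned k-uniform radius, one currency `dist1(loops) ≤ α`, `157α < L^{1−d}`) ★★ `recordDt_spec_uniform`, ★★ `recordQtC_sub_hop_recordDt_uniform_eq`.

HONEST FRAMING.  A definition by choice over theorems already landed ((o1-β)…(o1-ζ)); `D̃`'s ANALYTICITY in `B` (print: «an analytic function of B») is NOT asserted here (it is (o3)'s input, to be proved from
the analytic implicit-function structure, not assumed); nothing of (o3), `recordFluctInt`, FE-2 is touched; `stub_FE` (XXL) ∕ `stub_P0C` OPEN, ⟨27930⟩ OPEN (1∕3); NODE O 0∕1; COUNT 8∕28 · K 1∕4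
UNMOVED; finite `𝕋⁴_{L^K}` at fixed ε — NOT continuum ∕ OS; **the Yang–Mills mass gap (Clay) is NOT proved by any of this.**  No `sorry`, no `instance`, no `notation`; standard axioms only.
-/

noncomputable section

open scoped BigOperators Matrix.Norms.L2Operator Topology

open Set Metric Filter

namespace Summit.QuantumFields.YangMills.Theorems.BalabanUVNodesPortS1

open Summit.QuantumFields.YangMills.Theorems.K0RecordFormatNames
open Literature.MathematicalPhysics.QuantumFieldTheory.Balaban1983to89
open Literature.MathematicalPhysics.QuantumFieldTheory.Balaban1983to89.Node00
open Literature.MathematicalPhysics.QuantumFieldTheory.Balaban1983to89.T4Continuum (T4Family)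
open Literature.MathematicalPhysics.QuantumFieldTheory.Balaban1983to89.BlockAveraging (avgFun loopHol Small Idx)
open Literature.MathematicalPhysics.QuantumFieldTheory.Balaban1983to89.ExpMeanLog (expMeanLogSU)
open _root_.Matrix

variable (F : T4Family)

/-! ## §1  The name -/

open Classical in
/-- ★★★ **`recordDt F k K Vk ρ B` — print's `D̃(B)` at the record** (p.267: «there exists exactly one solution of this equation [`C̃(B − hX) = X`], we denote it by `D̃(B)`»): the pointwise selector —
SOME coarse field `X` in the closed ball of radius `4C₂ρ²` (`C₂ = 2∕R²`, `R = 1∕(10⁸dL)`) with `C̃_ℂ(Vk)(B − h_ℂ X) = X` if one exists, else `0`.  The radius `ρ` is QUANTIFIED (a parameter; admissible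
radii: ✓`exists_recordDt`; the pinned k-uniform one: §3).  Under the (o1-ε) letters the solution is unique (✓`eq_recordDt_of_solution`), so the choice is print's `D̃(B)`. JUNK (said): `0` off existence.
[cite: Balaban1987RG1, p.267; Balaban1985Variational, (96)–(98) p.292] -/
def recordDt (k K : ℕ) (Vk : GaugeField (F.P K) k (SU 2)) (ρ : ℝ) (B : FluctIdx F k K → ℂ) : PBond (F.P K) (k + 1) → MatA 2 :=
  if h : ∃ X : PBond (F.P K) (k + 1) → MatA 2,
      X ∈ closedBall (0 : PBond (F.P K) (k + 1) → MatA 2) (4 * (2 * 1 / (1 / (10 ^ 8 * (F.P K).d * (F.P K).L)) ^ 2) * ρ ^ 2) ∧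
        recordCtC F k K Vk (B - hopLinGraphC F k K Vk X) = X then h.choose else 0

/-! ## §2  Specification at a quantified radius -/

open Classical in
/-- JUNK FACE: off existence `recordDt = 0`. [cite: Balaban1987RG1, p.267 (bookkeeping)] -/
theorem recordDt_of_not_exists (k K : ℕ) (Vk : GaugeField (F.P K) k (SU 2)) (ρ : ℝ) (B : FluctIdx F k K → ℂ)
    (h : ¬ ∃ X : PBond (F.P K) (k + 1) → MatA 2,
      X ∈ closedBall (0 : PBond (F.P K) (k + 1) → MatA 2) (4 * (2 * 1 / (1 / (10 ^ 8 * (F.P K).d * (F.P K).L)) ^ 2) * ρ ^ 2) ∧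
        recordCtC F k K Vk (B - hopLinGraphC F k K Vk X) = X) :
    recordDt F k K Vk ρ B = 0 := by
  rw [recordDt, dif_neg h]

open Classical in
/-- SELECTOR FACE: on existence `recordDt` is a solution in the ball. [cite: Balaban1987RG1, p.267] -/
theorem recordDt_spec_of_exists (k K : ℕ) (Vk : GaugeField (F.P K) k (SU 2)) (ρ : ℝ) (B : FluctIdx F k K → ℂ)
    (h : ∃ X : PBond (F.P K) (k + 1) → MatA 2,
      X ∈ closedBall (0 : PBond (F.P K) (k + 1) → MatA 2) (4 * (2 * 1 / (1 / (10 ^ 8 * (F.P K).d * (F.P K).L)) ^ 2) * ρ ^ 2) ∧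
        recordCtC F k K Vk (B - hopLinGraphC F k K Vk X) = X) :
    recordDt F k K Vk ρ B ∈ closedBall (0 : PBond (F.P K) (k + 1) → MatA 2) (4 * (2 * 1 / (1 / (10 ^ 8 * (F.P K).d * (F.P K).L)) ^ 2) * ρ ^ 2) ∧
      recordCtC F k K Vk (B - hopLinGraphC F k K Vk (recordDt F k K Vk ρ B)) = recordDt F k K Vk ρ B := by
  rw [recordDt, dif_pos h]
  exact h.choose_spec

/-- ★ **SPEC**: under the (o1-ε) letters (`‖h_ℂ‖ ≤ b`, `9C₂bρ < 1`, `3ρ ≤ R`) and `‖B‖ < ρ`, `recordDt Vk ρ B` lies in the closed ball `4C₂ρ²` and solves `C̃_ℂ(B − h_ℂ D̃(B)) = D̃(B)` (✓`exists_recordDt` +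
`Exists.choose_spec`). [cite: Balaban1987RG1, p.267; Balaban1985Variational, (98) p.292] -/
theorem recordDt_spec (k K : ℕ) (hk : k + 1 ≤ (F.P K).m + (F.P K).K) (Vk : GaugeField (F.P K) k (SU 2)) {ε : ℝ}
    (hε : ∀ (c : PBond (F.P K) (k + 1)) (i : Idx (F.P K)), ‖loopM (coeField Vk) c i - 1‖ ≤ ε) (hε50 : ε ≤ 1 / 50)
    (hVk : ∀ c, Small expMeanLogSU Vk c) {b ρ : ℝ} (hb : 0 ≤ b) (hHop : ∀ X, ‖hopLinGraphC F k K Vk X‖ ≤ b * ‖X‖)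
    (hq : 9 * (2 * 1 / (1 / (10 ^ 8 * (F.P K).d * (F.P K).L)) ^ 2) * b * ρ < 1) (hρ : 3 * ρ ≤ 1 / (10 ^ 8 * (F.P K).d * (F.P K).L))
    {B : FluctIdx F k K → ℂ} (hB : ‖B‖ < ρ) :
    recordDt F k K Vk ρ B ∈ closedBall (0 : PBond (F.P K) (k + 1) → MatA 2) (4 * (2 * 1 / (1 / (10 ^ 8 * (F.P K).d * (F.P K).L)) ^ 2) * ρ ^ 2) ∧
      recordCtC F k K Vk (B - hopLinGraphC F k K Vk (recordDt F k K Vk ρ B)) = recordDt F k K Vk ρ B := by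
  obtain ⟨Dt, hDt⟩ := exists_recordDt F k K hk Vk hε hε50 hVk hb hHop hq hρ
  exact recordDt_spec_of_exists F k K Vk ρ B ⟨Dt B, hDt B hB⟩

/-- ★ **UNIQUENESS — every solution IS `recordDt`**: a family `Dt′` valued in the closed ball `4C₂ρ²` and solving the fixed-point equation on `‖B‖ < ρ` agrees with `recordDt Vk ρ` there
(lit ✓`B12Lineariz267.Dt_unique`). [cite: Balaban1987RG1, p.267 («exactly one solution»)] -/
theorem eq_recordDt_of_solution (k K : ℕ) (hk : k + 1 ≤ (F.P K).m + (F.P K).K) (Vk : GaugeField (F.P K) k (SU 2)) {ε : ℝ}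
    (hε : ∀ (c : PBond (F.P K) (k + 1)) (i : Idx (F.P K)), ‖loopM (coeField Vk) c i - 1‖ ≤ ε) (hε50 : ε ≤ 1 / 50)
    (hVk : ∀ c, Small expMeanLogSU Vk c) {b ρ : ℝ} (hb : 0 ≤ b) (hHop : ∀ X, ‖hopLinGraphC F k K Vk X‖ ≤ b * ‖X‖)
    (hq : 9 * (2 * 1 / (1 / (10 ^ 8 * (F.P K).d * (F.P K).L)) ^ 2) * b * ρ < 1) (hρ : 3 * ρ ≤ 1 / (10 ^ 8 * (F.P K).d * (F.P K).L))
    {Dt' : (FluctIdx F k K → ℂ) → (PBond (F.P K) (k + 1) → MatA 2)}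
    (h'ball : ∀ B, ‖B‖ < ρ → Dt' B ∈ closedBall (0 : PBond (F.P K) (k + 1) → MatA 2) (4 * (2 * 1 / (1 / (10 ^ 8 * (F.P K).d * (F.P K).L)) ^ 2) * ρ ^ 2))
    (h'fix : ∀ B, ‖B‖ < ρ → recordCtC F k K Vk (B - hopLinGraphC F k K Vk (Dt' B)) = Dt' B)
    {B : FluctIdx F k K → ℂ} (hB : ‖B‖ < ρ) : Dt' B = recordDt F k K Vk ρ B :=
  recordDt_unique F k K hk Vk hε hε50 hVk hb hHop hq hρ h'ball h'fix
    (fun _ hB' => (recordDt_spec F k K hk Vk hε hε50 hVk hb hHop hq hρ hB').1)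
    (fun _ hB' => (recordDt_spec F k K hk Vk hε hε50 hVk hb hHop hq hρ hB').2) hB

/-- `C̃_ℂ(Vk)(0) = 0`. [cite: Balaban1987RG1, p.267 (bookkeeping)] -/
theorem recordCtC_zero (k K : ℕ) (Vk : GaugeField (F.P K) k (SU 2)) (hVk : ∀ c, Small expMeanLogSU Vk c) : recordCtC F k K Vk 0 = 0 := by
  show recordQtC F k K Vk 0 - recordLQtC F k K Vk 0 = 0
  rw [recordQtC_zero_fun F k K Vk hVk, map_zero, sub_zero]

/-- ★ **POINTWISE UNIQUENESS**: any single `X` in the closed ball `4C₂ρ²` solving `C̃_ℂ(B − h_ℂ X) = X` at some `‖B‖ < ρ` IS `recordDt Vk ρ B` (lit ✓`B12Lineariz267.eq_Dt_of_fixedPt`).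
[cite: Balaban1987RG1, p.267 («exactly one solution»)] -/
theorem eq_recordDt_of_fixedPt (k K : ℕ) (hk : k + 1 ≤ (F.P K).m + (F.P K).K) (Vk : GaugeField (F.P K) k (SU 2)) {ε : ℝ}
    (hε : ∀ (c : PBond (F.P K) (k + 1)) (i : Idx (F.P K)), ‖loopM (coeField Vk) c i - 1‖ ≤ ε) (hε50 : ε ≤ 1 / 50)
    (hVk : ∀ c, Small expMeanLogSU Vk c) {b ρ : ℝ} (hb : 0 ≤ b) (hHop : ∀ X, ‖hopLinGraphC F k K Vk X‖ ≤ b * ‖X‖)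
    (hq : 9 * (2 * 1 / (1 / (10 ^ 8 * (F.P K).d * (F.P K).L)) ^ 2) * b * ρ < 1) (hρ : 3 * ρ ≤ 1 / (10 ^ 8 * (F.P K).d * (F.P K).L))
    {B : FluctIdx F k K → ℂ} (hB : ‖B‖ < ρ) {X : PBond (F.P K) (k + 1) → MatA 2}
    (hX : X ∈ closedBall (0 : PBond (F.P K) (k + 1) → MatA 2) (4 * (2 * 1 / (1 / (10 ^ 8 * (F.P K).d * (F.P K).L)) ^ 2) * ρ ^ 2))
    (hXfix : recordCtC F k K Vk (B - hopLinGraphC F k K Vk X) = X) : X = recordDt F k K Vk ρ B :=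
  B12Lineariz267.eq_Dt_of_fixedPt (quadAnalytic_recordCtC F k K hk Vk hε hε50 hVk) (by positivity) hb hHop hq hρ
    (fun _ hB' => (recordDt_spec F k K hk Vk hε hε50 hVk hb hHop hq hρ hB').1)
    (fun _ hB' => (recordDt_spec F k K hk Vk hε hε50 hVk hb hHop hq hρ hB').2) hB hX hXfix

/-- `D̃(0) = 0` under the letters (`X = 0` solves at `B = 0`: `C̃_ℂ(0) = 0`; pointwise uniqueness). [cite: Balaban1987RG1, p.267] -/
theorem recordDt_zero (k K : ℕ) (hk : k + 1 ≤ (F.P K).m + (F.P K).K) (Vk : GaugeField (F.P K) k (SU 2)) {ε : ℝ}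
    (hε : ∀ (c : PBond (F.P K) (k + 1)) (i : Idx (F.P K)), ‖loopM (coeField Vk) c i - 1‖ ≤ ε) (hε50 : ε ≤ 1 / 50)
    (hVk : ∀ c, Small expMeanLogSU Vk c) {b ρ : ℝ} (hb : 0 ≤ b) (hHop : ∀ X, ‖hopLinGraphC F k K Vk X‖ ≤ b * ‖X‖)
    (hq : 9 * (2 * 1 / (1 / (10 ^ 8 * (F.P K).d * (F.P K).L)) ^ 2) * b * ρ < 1) (hρ : 3 * ρ ≤ 1 / (10 ^ 8 * (F.P K).d * (F.P K).L)) (hρ0 : 0 < ρ) :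
    recordDt F k K Vk ρ 0 = 0 :=
  (eq_recordDt_of_fixedPt F k K hk Vk hε hε50 hVk hb hHop hq hρ (B := 0) (by simpa using hρ0) (X := 0)
    (mem_closedBall_self (by positivity)) (by rw [map_zero, sub_zero, recordCtC_zero F k K Vk hVk])).symm

/-- **«D̃(B) has an expansion beginning with quadratic terms»**: `‖recordDt Vk ρ B‖ ≤ 4C₂‖B‖²` on `‖B‖ < ρ`. [cite: Balaban1987RG1, p.267; Balaban1985Variational, (55) p.286] -/
theorem norm_recordDt_le_sq (k K : ℕ) (hk : k + 1 ≤ (F.P K).m + (F.P K).K) (Vk : GaugeField (F.P K) k (SU 2)) {ε : ℝ}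
    (hε : ∀ (c : PBond (F.P K) (k + 1)) (i : Idx (F.P K)), ‖loopM (coeField Vk) c i - 1‖ ≤ ε) (hε50 : ε ≤ 1 / 50)
    (hVk : ∀ c, Small expMeanLogSU Vk c) {b ρ : ℝ} (hb : 0 ≤ b) (hHop : ∀ X, ‖hopLinGraphC F k K Vk X‖ ≤ b * ‖X‖)
    (hq : 9 * (2 * 1 / (1 / (10 ^ 8 * (F.P K).d * (F.P K).L)) ^ 2) * b * ρ < 1) (hρ : 3 * ρ ≤ 1 / (10 ^ 8 * (F.P K).d * (F.P K).L))
    {B : FluctIdx F k K → ℂ} (hB : ‖B‖ < ρ) :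
    ‖recordDt F k K Vk ρ B‖ ≤ 4 * (2 * 1 / (1 / (10 ^ 8 * (F.P K).d * (F.P K).L)) ^ 2) * ‖B‖ ^ 2 :=
  norm_recordDt_le F k K hk Vk hε hε50 hVk hb hHop hq hρ
    (fun _ hB' => (recordDt_spec F k K hk Vk hε hε50 hVk hb hHop hq hρ hB').1)
    (fun _ hB' => (recordDt_spec F k K hk Vk hε hε50 hVk hb hHop hq hρ hB').2) hB

/-- The size of the correction: `‖h_ℂ D̃(B)‖ ≤ 4C₂b‖B‖²` and `≤ ρ`. [cite: Balaban1987RG1, p.267; Balaban1985Variational, (98) p.292] -/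
theorem norm_hop_recordDt_le' (k K : ℕ) (hk : k + 1 ≤ (F.P K).m + (F.P K).K) (Vk : GaugeField (F.P K) k (SU 2)) {ε : ℝ}
    (hε : ∀ (c : PBond (F.P K) (k + 1)) (i : Idx (F.P K)), ‖loopM (coeField Vk) c i - 1‖ ≤ ε) (hε50 : ε ≤ 1 / 50)
    (hVk : ∀ c, Small expMeanLogSU Vk c) {b ρ : ℝ} (hb : 0 ≤ b) (hHop : ∀ X, ‖hopLinGraphC F k K Vk X‖ ≤ b * ‖X‖)
    (hq : 9 * (2 * 1 / (1 / (10 ^ 8 * (F.P K).d * (F.P K).L)) ^ 2) * b * ρ < 1) (hρ : 3 * ρ ≤ 1 / (10 ^ 8 * (F.P K).d * (F.P K).L))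
    {B : FluctIdx F k K → ℂ} (hB : ‖B‖ < ρ) :
    ‖hopLinGraphC F k K Vk (recordDt F k K Vk ρ B)‖ ≤ 4 * (2 * 1 / (1 / (10 ^ 8 * (F.P K).d * (F.P K).L)) ^ 2) * b * ‖B‖ ^ 2 ∧
      ‖hopLinGraphC F k K Vk (recordDt F k K Vk ρ B)‖ ≤ ρ :=
  norm_hop_recordDt_le F k K hk Vk hε hε50 hVk hb hHop hq hρ
    (fun _ hB' => (recordDt_spec F k K hk Vk hε hε50 hVk hb hHop hq hρ hB').1)
    (fun _ hB' => (recordDt_spec F k K hk Vk hε hε50 hVk hb hHop hq hρ hB').2) hB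

/-- ★★ **THE LINEARISATION AT `recordDt`**: `Q̃_ℂ(B − h_ℂ D̃(B)) = LQ̃_ℂ B` for `‖B‖ < ρ`, under the letters and the `b₀`-letter `RecordB0BlockInvertible`. [cite: Balaban1987RG1, p.267 (displayed equation)] -/
theorem recordQtC_sub_hop_recordDt_eq (k K : ℕ) (hk : k + 1 ≤ (F.P K).m + (F.P K).K) (Vk : GaugeField (F.P K) k (SU 2)) {ε : ℝ}
    (hε : ∀ (c : PBond (F.P K) (k + 1)) (i : Idx (F.P K)), ‖loopM (coeField Vk) c i - 1‖ ≤ ε) (hε50 : ε ≤ 1 / 50)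
    (hVk : ∀ c, Small expMeanLogSU Vk c) (hA : RecordB0BlockInvertible F k K Vk) {b ρ : ℝ} (hb : 0 ≤ b) (hHop : ∀ X, ‖hopLinGraphC F k K Vk X‖ ≤ b * ‖X‖)
    (hq : 9 * (2 * 1 / (1 / (10 ^ 8 * (F.P K).d * (F.P K).L)) ^ 2) * b * ρ < 1) (hρ : 3 * ρ ≤ 1 / (10 ^ 8 * (F.P K).d * (F.P K).L))
    {B : FluctIdx F k K → ℂ} (hB : ‖B‖ < ρ) :
    recordQtC F k K Vk (B - hopLinGraphC F k K Vk (recordDt F k K Vk ρ B)) = recordLQtC F k K Vk B :=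
  recordQtC_sub_hop_recordDt F k K hk Vk hε hε50 hVk hA hb hHop hq hρ
    (fun _ hB' => (recordDt_spec F k K hk Vk hε hε50 hVk hb hHop hq hρ hB').1)
    (fun _ hB' => (recordDt_spec F k K hk Vk hε hε50 hVk hb hHop hq hρ hB').2) hB

/-! ## §3  Specification at the pinned k-uniform radius `ρ₀(d, L, α)` -/

/-- ★★ **SPEC AT THE PINNED RADIUS** (one currency: `dist1` of the (0.4) loop variables `≤ α`, `157α < L^{1−d}`): with `b = 6∕(L^{1−d} − 157α)`, `R = 1∕(10⁸dL)`, `C₂ = 2∕R²`,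
`ρ₀ = min (R∕3) (1∕(18C₂(b+1)))`, for `‖B‖ < ρ₀` the value `recordDt Vk ρ₀ B` is in the closed ball `4C₂ρ₀²` and solves the fixed-point equation ((o1-ζ)'s letters discharged: ✓`norm_hopLinGraphC_le`,
✓`recordDt_smallness_of_radius`). [cite: Balaban1987RG1, p.267; Balaban1985Variational, (98) p.292] -/
theorem recordDt_spec_uniform (k K : ℕ) (hk : k + 1 ≤ (F.P K).m + (F.P K).K) (Vk : GaugeField (F.P K) k (SU 2)) {α : ℝ}
    (hα : ∀ (c : PBond (F.P K) (k + 1)) (i : Idx (F.P K)), dist1 (loopHol Vk c i) ≤ α) (hαL : 157 * α < (((F.P K).L : ℝ) ^ ((F.P K).d - 1))⁻¹)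
    {B : FluctIdx F k K → ℂ}
    (hB : ‖B‖ < min ((1 : ℝ) / (10 ^ 8 * (F.P K).d * (F.P K).L) / 3)
          (1 / (18 * (2 * 1 / (1 / (10 ^ 8 * (F.P K).d * (F.P K).L)) ^ 2) * (6 / ((((F.P K).L : ℝ) ^ ((F.P K).d - 1))⁻¹ - 157 * α) + 1)))) :
    recordDt F k K Vk (min ((1 : ℝ) / (10 ^ 8 * (F.P K).d * (F.P K).L) / 3)
          (1 / (18 * (2 * 1 / (1 / (10 ^ 8 * (F.P K).d * (F.P K).L)) ^ 2) * (6 / ((((F.P K).L : ℝ) ^ ((F.P K).d - 1))⁻¹ - 157 * α) + 1)))) B ∈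
        closedBall (0 : PBond (F.P K) (k + 1) → MatA 2) (4 * (2 * 1 / (1 / (10 ^ 8 * (F.P K).d * (F.P K).L)) ^ 2) *
          min ((1 : ℝ) / (10 ^ 8 * (F.P K).d * (F.P K).L) / 3)
            (1 / (18 * (2 * 1 / (1 / (10 ^ 8 * (F.P K).d * (F.P K).L)) ^ 2) * (6 / ((((F.P K).L : ℝ) ^ ((F.P K).d - 1))⁻¹ - 157 * α) + 1))) ^ 2) ∧
      recordCtC F k K Vk (B - hopLinGraphC F k K Vk (recordDt F k K Vk (min ((1 : ℝ) / (10 ^ 8 * (F.P K).d * (F.P K).L) / 3)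
          (1 / (18 * (2 * 1 / (1 / (10 ^ 8 * (F.P K).d * (F.P K).L)) ^ 2) * (6 / ((((F.P K).L : ℝ) ^ ((F.P K).d - 1))⁻¹ - 157 * α) + 1)))) B)) =
        recordDt F k K Vk (min ((1 : ℝ) / (10 ^ 8 * (F.P K).d * (F.P K).L) / 3)
          (1 / (18 * (2 * 1 / (1 / (10 ^ 8 * (F.P K).d * (F.P K).L)) ^ 2) * (6 / ((((F.P K).L : ℝ) ^ ((F.P K).d - 1))⁻¹ - 157 * α) + 1)))) B := by
  have hα50 : α ≤ 1 / 50 := alpha_le_fiftieth_of_lt F K hαL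
  have hα24 : α ≤ 1 / 24 := hα50.trans (by norm_num)
  have hθ : 0 < (((F.P K).L : ℝ) ^ ((F.P K).d - 1))⁻¹ - 157 * α := sub_pos.2 hαL
  have hb : (0 : ℝ) ≤ 6 / ((((F.P K).L : ℝ) ^ ((F.P K).d - 1))⁻¹ - 157 * α) := by positivity
  have hd : (1 : ℝ) ≤ (F.P K).d := by exact_mod_cast (F.P K).hd
  have hL : (1 : ℝ) ≤ (F.P K).L := by exact_mod_cast (F.P K).hL.2.le
  have hR : (0 : ℝ) < 1 / (10 ^ 8 * (F.P K).d * (F.P K).L) := by positivity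
  have hC₂ : (0 : ℝ) < 2 * 1 / (1 / (10 ^ 8 * (F.P K).d * (F.P K).L)) ^ 2 := by positivity
  obtain ⟨_, hq, h3⟩ := recordDt_smallness_of_radius hR hC₂ hb
  exact recordDt_spec F k K hk Vk (norm_loopM_sub_one_le_of_dist1 F Vk hα) hα50 (small_of_dist1_le F Vk hα hα50) hb
    (norm_hopLinGraphC_le F k K hk Vk hα hα24 hαL) hq h3 hB

/-- ★★ **THE LINEARISATION AT THE PINNED RADIUS**: `Q̃_ℂ(B − h_ℂ D̃(B)) = LQ̃_ℂ B` for `‖B‖ < ρ₀(d, L, α)` (the `b₀`-letter by ✓`recordB0BlockInvertible_of_loopSmall`). [cite: Balaban1987RG1, p.267] -/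
theorem recordQtC_sub_hop_recordDt_uniform_eq (k K : ℕ) (hk : k + 1 ≤ (F.P K).m + (F.P K).K) (Vk : GaugeField (F.P K) k (SU 2)) {α : ℝ}
    (hα : ∀ (c : PBond (F.P K) (k + 1)) (i : Idx (F.P K)), dist1 (loopHol Vk c i) ≤ α) (hαL : 157 * α < (((F.P K).L : ℝ) ^ ((F.P K).d - 1))⁻¹)
    {B : FluctIdx F k K → ℂ}
    (hB : ‖B‖ < min ((1 : ℝ) / (10 ^ 8 * (F.P K).d * (F.P K).L) / 3)
          (1 / (18 * (2 * 1 / (1 / (10 ^ 8 * (F.P K).d * (F.P K).L)) ^ 2) * (6 / ((((F.P K).L : ℝ) ^ ((F.P K).d - 1))⁻¹ - 157 * α) + 1)))) :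
    recordQtC F k K Vk (B - hopLinGraphC F k K Vk (recordDt F k K Vk (min ((1 : ℝ) / (10 ^ 8 * (F.P K).d * (F.P K).L) / 3)
          (1 / (18 * (2 * 1 / (1 / (10 ^ 8 * (F.P K).d * (F.P K).L)) ^ 2) * (6 / ((((F.P K).L : ℝ) ^ ((F.P K).d - 1))⁻¹ - 157 * α) + 1)))) B)) =
      recordLQtC F k K Vk B := by
  have hα50 : α ≤ 1 / 50 := alpha_le_fiftieth_of_lt F K hαL
  have hα24 : α ≤ 1 / 24 := hα50.trans (by norm_num)
  have hθ : 0 < (((F.P K).L : ℝ) ^ ((F.P K).d - 1))⁻¹ - 157 * α := sub_pos.2 hαL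
  have hb : (0 : ℝ) ≤ 6 / ((((F.P K).L : ℝ) ^ ((F.P K).d - 1))⁻¹ - 157 * α) := by positivity
  have hd : (1 : ℝ) ≤ (F.P K).d := by exact_mod_cast (F.P K).hd
  have hL : (1 : ℝ) ≤ (F.P K).L := by exact_mod_cast (F.P K).hL.2.le
  have hR : (0 : ℝ) < 1 / (10 ^ 8 * (F.P K).d * (F.P K).L) := by positivity
  have hC₂ : (0 : ℝ) < 2 * 1 / (1 / (10 ^ 8 * (F.P K).d * (F.P K).L)) ^ 2 := by positivity
  obtain ⟨_, hq, h3⟩ := recordDt_smallness_of_radius hR hC₂ hb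
  exact recordQtC_sub_hop_recordDt_eq F k K hk Vk (norm_loopM_sub_one_le_of_dist1 F Vk hα) hα50 (small_of_dist1_le F Vk hα hα50)
    (recordB0BlockInvertible_of_loopSmall F k K hk Vk hα hα24 hαL) hb (norm_hopLinGraphC_le F k K hk Vk hα hα24 hαL) hq h3 hB

end Summit.QuantumFields.YangMills.Theorems.BalabanUVNodesPortS1

end
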